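import Literature.MathematicalPhysics.QuantumFieldTheory.Balaban1983to89.Node00.TkOfRecord
import Literature.MathematicalPhysics.QuantumFieldTheory.Balaban1983to89.B12RegularSpaces111
import Literature.MathematicalPhysics.QuantumFieldTheory.Balaban1983to89.B14RegularSpaces234
import Literature.MathematicalPhysics.QuantumFieldTheory.Balaban1983to89.B14Eq225Concrete
import Literature.MathematicalPhysics.QuantumFieldTheory.Balaban1983to89.TreeLengthTorus
import Literature.MathematicalPhysics.QuantumFieldTheory.Balaban1983to89.Node00.LocalizedTermsShape

/-!
# NODE 00 — DEFINER ₇b (T-side), FILE 11b: the FRAME of the localized renormalization expansions (2.23)–(2.42) [III]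
# OF RECORD — the localization domains `𝐃_j` with `d_j` on the torus, the complex configurations `(𝐔, 𝐉)`, the spaces
# `U^c_j(X, α₀, α₁)` ((I.1.11)–(1.16)) and `Ũ^c_j(X, α̃₀, α̃₁)` ((2.34)–(2.39)), the summation ranges of (2.26)∕(2.30)∕(2.41) and the
# action data (2.23), typed as a CONCRETE `Step.LFTower` + r11's `B14.Eq225Concrete.concrete`, with only the TERM VALUES left as data

Cell `pub-ymgap`, NODE 00, definer seat ₇b∕₉∕₁₀∕₁₁ (`pub-ymgap-node00-def-T`), DEDUP №11 step 11b (director LINE №54: 11a `TkOfRecord` (landed) → **11b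
`Sect2FrameOfRecord`** → 11c `Sect2FormOfRecord` → 11d `Record11` = the restate predicate).  [I] = [Balaban1987RG1] (held `paper:balaban1987-cmp109-rg-i-small-field`,
journal page = PDF page + 248), [III] = [Balaban1988Convergent] (held `paper:balaban1988-cmp119-convergent-renormalization`, journal page = PDF page + 242).
Source displays read on the rendered PDFs, [III] pp. 258–261 and [I] pp. 257, 262:

  (2.23)  `A_k({Ω_j},{Λ_j}, U_k, A) = −A(1∕g_k²(·), U_k) + 𝐄_k(U_k) + 𝐑_k(U_k) + 𝐁_k(U_k, A) − E_k`;   (2.24) `1∕g_k²(·)` with the smearing functions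
          `φ_j` («e.g. φ_j ∈ C₀^∞(Λ_j), φ_j = 1 on Λ_j^{∼−1}»);   (2.25) `𝐄_k(U_k) = Σ_{j=1}^{k} [𝐄^{(j)}(Λ_j, U_k) − 𝐄^{(j)}(Λ_j, 1) − β_j(g_{j−1}) A(φ_j, U_k)]`;
  (2.26)  `𝐄^{(j)}(Λ_j, U_k) = Σ_{z ∈ T_1^{(j)} ∩ Λ_j⁰} 𝐄^{(j)}(U_k, z)`, Λ_j⁰ = «removing one layer of the MR_j-cubes from Λ_j»;   (2.27) `𝐄^{(j)}(U_k, z) =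
          Σ_{X ∈ 𝐃_j, z ∈ X ⊂ Λ_j} 𝐄^{(j)}(X, U_k, z)` with (i) «it depends on U_k restricted to X», (ii) «there exists an analytic function 𝐄^{(j)}(X, (𝐔,𝐉), z) of
          the variables (𝐔,𝐉) ∈ U^c_j(X, α_{0,j}, α_{1,j}), which is an extension of this term», (iii) «invariant with respect to gauge transformations (1.10) [I]»,
          (iv) `|𝐄^{(j)}(X, (𝐔,𝐉), z)| ≤ E₀ exp(−κ d_j(X))`;   (2.28) `α_{0,j}, α_{1,j}` as functions of `g_j`;
  (2.30)  `𝐑_k(U_k) = Σ_j [𝐑^{(j)}(Λ_j, U_k) − 𝐑^{(j)}(Λ_j, 1)]`, «summation over localization domains X ∈ 𝐃_j contained in Λ_j^{∼−1} … unions of the MR_j-cubes»,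
          (2.31) `|𝐑^{(j)}(X, (𝐔,𝐉))| ≤ g_j^{κ₀} exp(−κ d_j(X))`;
  (2.34)–(2.39) the space `Ũ^c_j(X, α̃₀, α̃₁)`: (i) the bounds (2.34)–(2.37) against `U_{p,X}(M˙(𝐔))` «on X ∩ (Ω_n ∖ Ω_{n+1}) for n = 1,…,j−1, or on X ∩ Ω_j for n = j»,
          (ii) «for each cube □ ⊂ Ω_n ∖ Ω_{n+2}, □ ∩ Ω^c_{n+1} ≠ ∅ … of the size CML^nξ, or □ ⊂ Ω_j and of the size CM, there exists a gauge transformation u …» (2.38),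
          (iii) (2.39);   (2.40)–(2.42) `𝐁_k = Σ_j 𝐁^{(j)}`, «the sum is over domains X ∈ 𝐃_j such, that X ∩ Ω_j ≠ ∅, and X ∩ Z_j^∼ ≠ ∅», (i)–(iv) with
          «analytic function on the space Ũ^c_j(X, α̃₀, α̃₁)» and `|𝐁^{(j)}(X, (𝐔,𝐉,A,{S_i ∩ X}))| ≤ B₀ exp(−κ d_j(X))`;
  [I] p. 257: the cubes `π_j` («M-cubes of T^{(j)}»), «every localization domain X is a union of … cubes from π_j», the class `𝐃_j`, the linear size `d_j(X)`;
  [I] p. 262: «𝐔 … has values in Gᶜ, … 𝐉 … has values in 𝔤ᶜ. A Gᶜ-valued gauge transformation u acts on pairs (𝐔, 𝐉) … `(𝐔, 𝐉)^u = (u₋𝐔u₊⁻¹, R(u₋)𝐉)` (1.10)»,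
          «The space U^c_j(X, α₀, α₁, γ₀) is a union of orbits [(𝐔, 𝐉)] determined by configurations 𝐔, 𝐉 satisfying the four conditions» (1.11)–(1.16),
          (1.12) «for each cube □ ⊂ X of a size O(1)LM», (1.16) on «X^{∼−2} … taking away two layers of cubes from π_j».

WHAT THIS FILE IS.  r11 (cell pub-balaban) typed every INGREDIENT of the §2 inductive description GENERICALLY and said so: `Step.LFTower P G Φ 𝒢 𝔄` abstracts
the configuration type `Φ`, the gauge group `𝒢`, the domain classes `sys`, the points `Pt`, the spaces `space`∕`spaceB`, the embedding of backgrounds, the action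
and locality («located residual parameters»); `Step.LFHyp`∕`B14.Eq227LocalizedTerms.LFHypAnalytic` are the laws (i)–(iv), (2.31), (2.42) over such a tower;
`B14.Eq225Concrete.concrete` is the action data (2.23)–(2.25) over a tower and three range predicates; `B12RegularSpaces111` ([I] (1.9)–(1.16)) and
`B14RegularSpaces234` ((2.34)–(2.39)) are the spaces over FRAMES (regions, cubes, background-function recipes); `TreeLengthTorus.tsys` is `𝐃_j` with `d_j` on a
torus of cube indices.  NO CONCRETE `LFTower` EXISTED in the tree (grep at authoring time).  This file PINS THE FRAME for NODE 00's torus `F.P K` along a (2.18)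
sequence of record (`SeqOfRecord`, FILE 4), so that 11c's form predicate («slot `s` = 𝐓_k(s)[exp A_k(s)] on the χ-support», with `A_k` of (2.23)) quantifies
over the TERM VALUES `𝐄^{(j)}(X, ·, z), 𝐑^{(j)}(X, ·), 𝐁^{(j)}(X, ·, ·)` ONLY (`Sect2.TermValues`) and not over frames — the anti-junk point of DEDUP №11: a law
∃-quantified over a whole `LFTower` is closable by a junk tower whose spaces are `∅` (analyticity and bounds on `∅` are vacuous) and whose `𝐃_j` are empty types.

DICTIONARY (print ↦ decl; `P = F.P K`, level `0` = the `ε = L^{−K}` lattice `T_ε`, level `j` = `T^{(j)}` with `2L^{m+K−j}` sites per direction (`Setup`)):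
  `T_η ⊃ X` as a site set ↦ `Set (Site P 0)`;  `z ∈ T_1^{(j)}` ↦ `z : Site P j`, «z ∈ X» ↦ `B10Eq38TorusDomains.toFine j z ∈ …`;  the `M`-cubes of `T^{(j)}` (= `L^j M`
  fine sites per side) ↦ `cubeEnl P (side P.L M j) a 0` (FILE 1's cubes, r11's `side`);  **`𝐃_j` with `d_j`** ↦ `Sect2.domSys P M j := TreeLengthTorus.tsys P.d
  (domCount P M j)` (non-empty wall-connected families of cube indices on the index torus `(ZMod ⌈2L^{m+K}∕(L^j M)⌉)^d`, `d_j = torusTreeLen`), `X` as sites ↦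
  `Sect2.domSites`, the single cube ↦ `Sect2.cubeDom` (`dj_cubeDom : d_j = 0`);  `Y^{∼n}`, `Y^{∼−n}` for `s`-cubes ↦ `Sect2.enlT P s n`, `Sect2.innerT P s n` (r11's
  `enl`∕`innerN` transported through `B15Eq112TorusCover.cover`, the idiom of `B14Eq213DetSet.innerTwoT`);  **`(𝐔, 𝐉)`** ↦ `Sect2.CPair P 𝔸 = (PBond P 0 → 𝔸) ×
  (PBond P 0 → 𝔸)` for ONE complete normed `ℂ`-algebra `𝔸` carrying r11's value model `B12RegularSpaces111.Model 𝔸` {`G`, `Gᶜ ⊂ 𝔸ˣ`, `𝔤ᶜ ⊂ 𝔸`} (11d instantiates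
  `𝔸 := ℂ^N →L[ℂ] ℂ^N` with its global operator-norm instances; no local instances here);  the units-valued pairs of r11's spaces ↦ `Sect2.embedPair`;  (1.10) ↦
  `Sect2.cAct` (`cAct_embedPair`: it IS r11's `B12RegularSpaces111.act`, by `rfl`);  the `Gᶜ`-valued gauge transformations ↦ `Site P 0 → S.𝓜.Gc`;  a real background
  `U_k` read in `Φ` ↦ `Sect2.ofBackgroundC ι U = (ι ∘ U, 0)`;  (i) «depends on U_k restricted to X» ↦ `Sect2.agreeOnSet (domSites …)` (agreement on the bonds with
  both endpoints in `X`);  a site set as a region (plaquettes, bonds, derivative stencils inside it) ↦ `Sect2.regionOfSet`;  **`U^c_j(X, α₀, α₁)`** ↦ `Sect2.spaceI S Rz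
  M j Y α₀ α₁ := embedPair '' B12RegularSpaces111.space' S.𝓜 (frameI Rz M j Y) (StepConsts.ofParams P S.cB j) α₀ α₁` with the frame `Sect2.frameI` {X, the (1.12) cubes
  `Sect2.cubesI`, `X^{∼−2}`, the (1.15) recipe};  **`Ũ^c_j(X, α̃₀, α̃₁)`** ↦ `Sect2.spaceMS … Ω := embedPair '' B14RegularSpaces234.space234 S.𝓜 (frameMS Rz M j Y Ω)
  (MSConsts.ofParams P S.βc S.B S.C S.Mr j) (α_{0,·} ∘ g) (α_{1,·} ∘ g)` with `Sect2.frameMS` {X, the layers `Sect2.layerSet`, the (2.38) cubes `Sect2.cubesMS`, the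
  (2.35) recipe} and `α̃ᵢ = {LFConsts.alphaᵢ (g_n)}_n` ((2.28), r11);  `Λ_j⁰` ↦ `Sect2.lambda0`;  the ranges of (2.26)–(2.27) ∕ (2.30) ∕ (2.41) ↦ `Sect2.admE` ∕ `admR` ∕
  `admB` (`…_eq_true_iff`);  the term values ↦ `Sect2.TermValues` {E, R, B};  **the tower** ↦ `Sect2.towerOfTerms S Rz M Ω t : LFTower P G (CPair P 𝔸) (Site P 0 →
  S.𝓜.Gc) (Tk.SFluct P V)` and, along a sequence of record, `sect2TowerOfRecord F N V K S Rz s t`;  **(2.23)–(2.25)** ↦ `Sect2.actionDataOfTerms` ∕ `sect2ActionDataOfRecord … s t a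
  E_k := B14.Eq225Concrete.concrete (tower) admE admR admB φ k a E_k` (`A(1∕g_k²(·), U) = smearedWilson (invSq flow φ k) U`, `A(φ_j, U) = smearedWilson (φ j) U`, r11),
  with `action23_actionDataOfTerms` = r11's `action23_concrete` at the record;  [I] (0.24)'s real family `𝐄^{(j)}(X, U)` ↦ `Sect2.realFamilyOfTerms : Node00.LocalizedFamily
  P G` (object ₈'s shape, `Node00.LocalizedTermsShape`), `Σ_{z ∈ X} Re 𝐄^{(j)}(X, (ιU, 0), z)` at `g_{j−1}`, with `realFamilyOfTerms_localized` ((2.27)(i) ⇒ ₈'s `Localized`).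

THE SETTING AND THE RESIDUAL.  `Sect2.Setting 𝔸 G` = θ-LEVEL inputs (NOT residual): the value model `𝓜`, the embedding `ι : G →* 𝔸ˣ` (provisos `Setting.Laws`:
`ι(G) ⊂ 𝓜.G ≤ 𝓜.Gc`), the constants `O(1)LMB` of (1.12), `β, B, C, M` of (2.34)–(2.38), the term constants `LFConsts` {A₀ p₀ C₀ q₀ C₁ q₁ κ κ₀ E₀ B₀ γ} and the
flow `(g_j, β_j)`; [I]'s cube size `M` is passed separately (it indexes the type of the (2.18) sequences).  `Sect2.Residual P 𝔸` = the LOCATED RESIDUAL DATUM of the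
frame, NOT constructed here and SAID: `bgI j Y` = the complexified background functions `𝐔 ↦ (U_n(M˙(𝐔)), J_n(M˙(𝐔)))_{n ≤ j}` of (I.1.15) entering (iv) (1.16);
`bgMS j Y` = `𝐔 ↦ (U_{p,X}(M˙(𝐔)), 𝐉_{p,X}(M˙(𝐔)))_p` of (2.35) with their lattices and layer regions entering (2.34)–(2.37); `phi j` = the smearing functions
`φ_j` of (2.24) (print: «e.g.»).  Print builds the first two in [14], [15] as ANALYTIC CONTINUATIONS of the minimisers to `Gᶜ`-valued fields — no tree object; a
`Classical.epsilon` recipe would be junk-laden and is out of scope.  JUNK ANALYSIS (what a wrong recipe does): it changes conditions (iv)∕(2.34)–(2.37), hence the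
SPACE on which 11c demands (2.27)(ii),(iv) ∕ (2.31) ∕ (2.41)(ii), (2.42): a recipe making the proximity conditions trivial ENLARGES the space (the law demanded
becomes STRONGER than print's — not dischargeable by a knitter), one making them unsatisfiable EMPTIES it (the law becomes VACUOUS); 11d binds the recipe as
a named datum of the restate predicate and the knitters' discharge must supply print's.  Nothing in this file depends on which recipe is supplied.

LOCATED READINGS (said; none is print's theorem, each is a modelling decision a successor may refine):
 (ℓ1) `𝐃_j` := r11's torus catalogue `tsys` (DIVERGENCE D-pv22.1 of `TreeLengthTorus`: wall-adjacency of cube indices, tree length in cube units); the index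
      torus has `domCount = (2L^{m+K} − 1)∕(L^j M) + 1 = ⌈2L^{m+K}∕(L^j M)⌉` indices per direction — its wrap-around adjacency is the geometric one iff
      `L^j M · domCount = 2L^{m+K}` (exact tiling; else the last cubes are partial, exactly as for FILE 1's `cubeIndices`, whose ceiling convention `domCount` matches:
      `(n + s − 1)∕s = (n − 1)∕s + 1` for `s ≥ 1`) — a numeric side condition on `(L, M, m, K)` of the «compatible partitions» kind, not displayed;
 (ℓ2) «of a size O(1)LM» (1.12) := the `LM`-cubes of `T^{(j)}` meeting `X` (`O(1) := 1`), «of the size CML^nξ»∕«CM» (2.38) := the `M`-cubes of `T^{(n)}` (`C` enters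
      the BOUND (2.38) through `MSConsts.C` only) — finer cube families than print's for `O(1), C > 1`;
 (ℓ3) the three `∼`-operations of the ranges — `Λ_j⁰` (2.26), `Λ_j^{∼−1}` (2.30), `Z_j^∼` (2.41), `Z_j = Λ_jᶜ` (2.3) — are all taken for the `MR_j`-cubes of `T^{(j)}`
      (`Sect2.zSide P ν M g j = dCubeSide L M (RkOfRecord L r g_j) j`, the partition of FILE 4's `DOfRecord`), per p. 260 «unions of the MR_j-cubes in the lattice T_ξ»;
 (ℓ4) a derivative triple `(x, μ, ν)` belongs to the region of `Y` when the four corners `x, x+e_μ, x+e_ν, x+e_μ+e_ν` lie in `Y` (the stencil of `∇_μ` on a `ν`-bond);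
 (ℓ5) print indexes the layers `n = 1, …, j` from the unit lattice of the current step; here level `0` is `T_ε` and `n` ranges over `0, …, j` (r11's indexing in
      `B14RegularSpaces234`); layers above `j` are empty;
 (ℓ6) `Pt j := Site P j` (all of `T^{(j)}`); «z ∈ T_1^{(j)} ∩ Λ_j⁰» and «z ∈ X ⊂ Λ_j» are in `admE`;
 (ℓ7) the gauge group of the tower is the `Gᶜ`-VALUED transformations `Site P 0 → S.𝓜.Gc` ([I] p. 262 verbatim; r11's `space` is saturated by exactly these), so
      that `LFHyp.gaugeInvE∕R` on the tower of record is (2.27)(iii) as printed ((2.41)(iii) asks `G`-valued only — weaker; `LFHyp` has no `B`-invariance field);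
 (ℓ8) the coupling argument of `E` is r11's (the terms are demanded analytic∕bounded for every `g ∈ [0, γ]`, (2.28)); `realFamilyOfTerms` reads it at `g_{j−1}` as (2.23) does.

VACUITY AUDIT.  (v1) `(domSys P M j).Dom` is a non-empty finite type: `cubeDom` (a single cube, `dj_cubeDom = 0`, `domSites_cubeDom`); the (2.26)∕(2.30)∕(2.41) sums of
`action23` are finite sums over it and over `Site P j` (instances from `tsys`∕`Setup`, no new instance).  (v2) `CPair P 𝔸` is a genuine normed `ℂ`-space (Pi∕Prod
instances of Mathlib); «analytic on the space» (`AnalyticOnNhd ℂ f (space …)`) is NOT vacuous whenever the space is non-empty, and NOT trivial: the spaces are subsets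
of the units-valued pairs, not open in `Φ`, and `AnalyticOnNhd` asks analyticity on a neighbourhood of each point.  (v3) The spaces CAN be empty (bad constants, an
unsatisfiable recipe) — then (ii)∕(iv) are vacuous AT THAT `(j, X)`; print's non-emptiness («the configurations U_k(V) restricted to X belong to U^c_j», [I] p. 263 ∕
[14]) is Theorem-1 content, surfacing in 11c as the displayed proviso that the background of record lies in the space — not asserted here.  (v4) `TermValues.zero`
inhabits the term values (the `k = 0` start of Theorem 1 has no terms).  (v5) `admE∕admR∕admB` are `decide`s of the displayed set conditions (`…_eq_true_iff`),
nothing hidden; the tower does not depend on the term values in any frame field (`towerOfTerms_sys∕_flow∕_act∕_agreeOn∕_ofBackground` by `rfl`).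

HONEST SCOPE.  Definitions of record + `rfl`∕bookkeeping faces; 0 `sorry`; no `instance`, no `notation`, no attribute games; every decl carries its cite tag.  NOT
ASSERTED: anything of Bałaban — the inductive hypotheses (2.23)–(2.43), Theorem 2 [III], the existence of the analytic extensions, the bounds, [I]'s Theorem 1,
the construction of the background functions [14], [15].  NOT TYPED HERE (successors): the LAWS on the tower of record (11c: `LFHyp`, `LFHypAnalytic`, the identity
on the χ-support via FILE 11a's `TkOfRecord`), the Euclidean covariance (2.29)∕(2.32) (r11 `B14Eq229Covariance`, not consumed by 11c–11d), the (2.43) constant `E_k`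
(a real parameter `Ek` here), the `{S_j}`∕fluctuation datum (r11's operand slot `𝔄 := Tk.SFluct P V` of FILE 11a, passed through).  One finite `T⁴` torus at fixed
`ε = L^{−K}`; not continuum ∕ OS ∕ mass-gap ∕ Clay; counts unmoved (typed 28∕28 · discharged 5∕28).
-/

open MeasureTheory Set
open scoped BigOperators

namespace Literature.MathematicalPhysics.QuantumFieldTheory.Balaban1983to89.Node00

open Literature.MathematicalPhysics.QuantumFieldTheory.Balaban1983to89
open Step B14DomainGeom B14.Eq213MaximalDomains B15Eq112TorusCover TreeLengthTorus T4Continuum B14.Eq218Concrete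

noncomputable section

namespace Sect2

/-! ## §1  Torus geometry of the localization domains `X ∈ 𝐃_j` -/

section Geometry

variable (P : Params)

/-- `Y^{∼n}` on the torus for the `s`-cube partition: `n` layers of `s`-cubes added (pull back to the cover, r11's `enl`, push forward).
[cite: Balaban1988Convergent, (2.1)–(2.3) pp.254–255] -/
def enlT (s n : ℕ) (Y : Set (Site P 0)) : Set (Site P 0) :=
  cover P '' enl s n (cover P ⁻¹' Y)

/-- `Y^{∼−n}` on the torus for the `s`-cube partition: `n` layers of `s`-cubes removed (r11's `innerN` on the cover).
[cite: Balaban1988Convergent, (2.26) p.259 («removing one layer of the MR_j-cubes»)] -/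
def innerT (s n : ℕ) (Y : Set (Site P 0)) : Set (Site P 0) :=
  cover P '' innerN s n (cover P ⁻¹' Y)

/-- The number of `M`-cubes of `T^{(j)}` (side `L^j·M` fine sites) per direction, as a successor (so that `ZMod` of it is a nonempty finite
type without a registered instance): `⌈(2L^{m+K}) ∕ (L^j M)⌉` whenever `L^j M ≥ 1`. [cite: Balaban1987RG1, p.257 (the cubes π_j)] -/
abbrev domCount (M j : ℕ) : ℕ := (P.sitesPerDir 0 - 1) / side P.L M j + 1

/-- **`𝐃_j` OF RECORD with its linear size `d_j`**: the torus catalogue `TreeLengthTorus.tsys` of non-empty wall-connected families of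
`M`-cubes of `T^{(j)}` (`d_j` = `torusTreeLen`, the tree length in cube units = print's «length of a shortest tree graph … divided by M»).
[cite: Balaban1987RG1, p.257 (class 𝐃_j, d_j(X)); Balaban1988Convergent, (2.26)–(2.27) p.259] -/
def domSys (M j : ℕ) : LocDomainSys :=
  tsys P.d (domCount P M j)

/-- A torus cube index read on the cover window `{0, …, q−1}^d` (the index convention of `cubeIndices`∕`cubeEnl`). [cite: Balaban1987RG1, p.257 (bookkeeping)] -/
def liftIdx {n : ℕ} (x : TPt P.d n) : Pt P.d := fun i => ((x i).val : ℤ)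

/-- The localization domain `X ∈ 𝐃_j` READ AS A SET OF FINE SITES: the union of its `M`-cubes of `T^{(j)}`.
[cite: Balaban1987RG1, p.257 («every localization domain X is a union of … cubes from π_j»)] -/
def domSites (M j : ℕ) (X : (domSys P M j).Dom) : Set (Site P 0) :=
  ⋃ x ∈ (Subtype.val X : Finset (TPt P.d (domCount P M j))), cubeEnl P (side P.L M j) (liftIdx P x) 0

/-- A single `M`-cube of `T^{(j)}` as a localization domain of record (the smallest `X ∈ 𝐃_j`; non-vacuity of the (2.26)∕(2.30)∕(2.41) sums).
[cite: Balaban1987RG1, p.257 (the cubes π_j ⊂ 𝐃_j)] -/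
def cubeDom (M j : ℕ) (x : TPt P.d (domCount P M j)) : (domSys P M j).Dom :=
  ⟨{x}, Finset.singleton_nonempty x, fun a ha b hb => by
    rw [Finset.mem_singleton] at ha hb
    subst ha; subst hb
    exact Relation.ReflTransGen.refl⟩

variable {P} in
/-- A single cube has linear size `d_j = 0`. [cite: Balaban1987RG1, p.257 (d_j of a cube)] -/
theorem dj_cubeDom (M j : ℕ) (x : TPt P.d (domCount P M j)) : (domSys P M j).dj (cubeDom P M j x) = 0 :=
  torusTreeLen_singleton x

variable {P} in
/-- The sites of a single-cube domain are that cube. [cite: Balaban1987RG1, p.257 (bookkeeping)] -/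
theorem domSites_cubeDom (M j : ℕ) (x : TPt P.d (domCount P M j)) :
    domSites P M j (cubeDom P M j x) = cubeEnl P (side P.L M j) (liftIdx P x) 0 := by
  simp [domSites, cubeDom]

/-- A site set `Y ⊂ T_η` as a `B12RegularSpaces111.Region`: its plaquettes (all four corners in `Y`), its bonds (both endpoints in `Y`),
and its derivative triples `(x, μ, ν)` (the four corners `x, x+e_μ, x+e_ν, x+e_μ+e_ν` in `Y`). [cite: Balaban1987RG1, (1.11)–(1.14) p.262 («on X»)] -/
def regionOfSet (Y : Set (Site P 0)) : B12RegularSpaces111.Region P 0 where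
  plaqs := plaqInside Y
  bonds := {b | b.src ∈ Y ∧ b.tgt ∈ Y}
  dpairs := {q | q.1 ∈ Y ∧ q.1.shift q.2.1 ∈ Y ∧ q.1.shift q.2.2 ∈ Y ∧ (q.1.shift q.2.1).shift q.2.2 ∈ Y}

end Geometry

/-! ## §2  The complex configuration space `Φ` of the tower, the gauge action, locality -/

section Pairs

variable (P : Params) (𝔸 : Type*)

/-- **THE CONFIGURATION TYPE `Φ` OF THE TOWER OF RECORD**: pairs `(𝐔, 𝐉)` of `𝔸`-valued bond functions on the fine torus (print's variables
`(𝐔, 𝐉)`, `𝐔` `Gᶜ`-valued, `𝐉` `𝔤ᶜ`-valued, inside one complete normed `ℂ`-algebra `𝔸`; a normed `ℂ`-space, so that «analytic» = `AnalyticOnNhd ℂ`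
of `B14.Eq227LocalizedTerms.LFHypAnalytic` elaborates). [cite: Balaban1987RG1, (1.9)–(1.10) p.262; Balaban1988Convergent, (2.27)(ii) p.259] -/
abbrev CPair : Type _ := (PBond P 0 → 𝔸) × (PBond P 0 → 𝔸)

variable {P 𝔸}

/-- The units-valued pairs of `B12RegularSpaces111`∕`B14RegularSpaces234` read in `Φ`. [cite: Balaban1987RG1, (1.9) p.262] -/
def embedPair [Ring 𝔸] (Ψ : FieldPair P 0 𝔸ˣ 𝔸) : CPair P 𝔸 :=
  (fun b => (Ψ.U b : 𝔸), Ψ.J)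

/-- **(1.10)∕(I.1.10) on `Φ`**: `(𝐔, 𝐉)^u = (u₋𝐔u₊⁻¹, u₋𝐉u₋⁻¹)`. [cite: Balaban1987RG1, (1.10) p.262; Balaban1988Convergent, (2.27)(iii) p.259] -/
def cAct [Ring 𝔸] (u : Site P 0 → 𝔸ˣ) (φ : CPair P 𝔸) : CPair P 𝔸 :=
  (fun b => (u b.src : 𝔸) * φ.1 b * ((u b.tgt)⁻¹ : 𝔸ˣ), fun b => (u b.src : 𝔸) * φ.2 b * ((u b.src)⁻¹ : 𝔸ˣ))

/-- A real `G`-valued background field read in `Φ` through an embedding `ι : G →* 𝔸ˣ` (`𝐉 = 0`): the tower's `ofBackground`.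
[cite: Balaban1988Convergent, (2.27)(ii) p.259 («an extension of this term»)] -/
def ofBackgroundC [Ring 𝔸] {G : Type*} [Group G] (ι : G →* 𝔸ˣ) (U : GaugeField P 0 G) : CPair P 𝔸 :=
  (fun b => (ι (U b) : 𝔸), fun _ => 0)

/-- **(i) «it depends on U_k restricted to X»**: two configurations AGREE ON a site set `Y` iff they coincide on the bonds with both endpoints
in `Y`. [cite: Balaban1988Convergent, (2.27)(i) p.259] -/
def agreeOnSet (Y : Set (Site P 0)) (φ ψ : CPair P 𝔸) : Prop :=
  ∀ b : PBond P 0, b.src ∈ Y → b.tgt ∈ Y → φ.1 b = ψ.1 b ∧ φ.2 b = ψ.2 b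

/-- The action on `Φ` extends the action `B12RegularSpaces111.act` on units-valued pairs. [cite: Balaban1987RG1, (1.10) p.262] -/
theorem cAct_embedPair [Ring 𝔸] (u : Site P 0 → 𝔸ˣ) (Ψ : FieldPair P 0 𝔸ˣ 𝔸) :
    cAct u (embedPair Ψ) = embedPair (B12RegularSpaces111.act u Ψ) := by
  rfl

/-- `agreeOnSet` is reflexive (bookkeeping of (2.27)(i) «depends on U_k restricted to X»). [cite: Balaban1988Convergent, (2.27)(i) p.259 (bookkeeping)] -/
theorem agreeOnSet_refl (Y : Set (Site P 0)) (φ : CPair P 𝔸) : agreeOnSet Y φ φ :=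
  fun _ _ _ => ⟨rfl, rfl⟩

/-- `agreeOnSet` is symmetric (bookkeeping of (2.27)(i)). [cite: Balaban1988Convergent, (2.27)(i) p.259 (bookkeeping)] -/
theorem agreeOnSet_symm {Y : Set (Site P 0)} {φ ψ : CPair P 𝔸} (h : agreeOnSet Y φ ψ) : agreeOnSet Y ψ φ :=
  fun b h1 h2 => ⟨(h b h1 h2).1.symm, (h b h1 h2).2.symm⟩

/-- `agreeOnSet` is antitone in the set (bookkeeping of (2.27)(i): a term localized in `X` is localized in every larger set). [cite: Balaban1988Convergent, (2.27)(i) p.259 (bookkeeping)] -/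
theorem agreeOnSet_mono {Y Y' : Set (Site P 0)} (hY : Y ⊆ Y') {φ ψ : CPair P 𝔸} (h : agreeOnSet Y' φ ψ) : agreeOnSet Y φ ψ :=
  fun b h1 h2 => h b (hY h1) (hY h2)

/-- Real fields agreeing on the bonds of a site set give configurations of `Φ` agreeing there. [cite: Balaban1988Convergent, (2.27)(i) p.259 (bookkeeping)] -/
theorem agreeOnSet_ofBackgroundC [Ring 𝔸] {G : Type*} [Group G] (ι : G →* 𝔸ˣ) {Y : Set (Site P 0)} {U U' : GaugeField P 0 G}
    (h : ∀ b : PBond P 0, b.src ∈ Y → b.tgt ∈ Y → U b = U' b) : agreeOnSet Y (ofBackgroundC ι U) (ofBackgroundC ι U') :=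
  fun b h1 h2 => ⟨by simp [ofBackgroundC, h b h1 h2], rfl⟩

end Pairs

/-! ## §3  The frames of the spaces `U^c_j(X, α₀, α₁)` ((I.1.11)–(I.1.16)) and `Ũ^c_j(X, α̃₀, α̃₁)` ((2.34)–(2.39)) OF RECORD -/

section Frames

variable (P : Params) (𝔸 : Type*) [NormedRing 𝔸] [NormedAlgebra ℂ 𝔸] [CompleteSpace 𝔸]

/-- **THE LOCATED RESIDUAL DATUM OF THE FRAME** — what print IMPORTS from [14], [15] and this file does not construct: the complexified background
functions `𝐔 ↦ U_n(M˙(𝐔)), J_n(M˙(𝐔))` of (I.1.15) entering condition (iv) (I.1.16) of `U^c_j(X, α₀, α₁)`, and `𝐔 ↦ U_{p,X}(M˙(𝐔)), 𝐉_{p,X}(M˙(𝐔))`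
of (2.35) entering conditions (i)–(ii) of `Ũ^c_j(X, α̃₀, α̃₁)` (with their layer regions), one recipe per level `j` and domain `X` (read as a site
set); and the smearing functions `φ_j` of (2.24)–(2.25) («φ_j ∈ C₀^∞(Λ_j), = 1 on Λ_j^{∼−1}», left «e.g.» by print).  A junk recipe changes the
spaces on which the bounds (iv)∕(2.31)∕(2.42) are demanded — SAID; pinning these recipes is a successor file. [cite: Balaban1987RG1, (1.15)–(1.16) p.262; Balaban1988Convergent, (2.35) p.261, (2.24)–(2.25) p.259] -/
structure Residual where
  /-- `(j, X) ↦ (U_n(M˙(·)), J_n(M˙(·)))_{n ≤ j}` of (I.1.15) for the domain `X` (as a site set) at level `j` -/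
  bgI : ℕ → Set (Site P 0) → B12RegularSpaces111.BackgroundFns P 0 𝔸
  /-- `(j, X) ↦ (U_{p,X}(M˙(·)), 𝐉_{p,X}(M˙(·)))_p` of (2.35) with their lattices and layers -/
  bgMS : ℕ → Set (Site P 0) → B14RegularSpaces234.MSBackgroundFns P 0 𝔸
  /-- the smearing functions `φ_j` of (2.24)–(2.25) -/
  phi : ℕ → Plaq P 0 → ℝ

/-- **THE SETTING** (θ-level inputs, NOT residual): the value model `G ⊂ Gᶜ ⊂ 𝔸ˣ`, `𝔤ᶜ ⊂ 𝔸` of [I] p.262 with the embedding of the gauge group,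
[I]'s cube size `M`, the constant `O(1)LMB` of (I.1.12), the constants `β, B, C, M` of (2.34)–(2.38), the term constants `LFConsts` ((2.28), (2.31),
(2.42)) and the flow `(g_j, β_j)`; [I]'s cube size `M` (the cubes `π_j` of the localization domains = the `M` of the `MR_j`-cubes of (2.1)) is passed
separately (it is a type-level index of the (2.18) sequences of record). [cite: Balaban1987RG1, (1.12) p.262; Balaban1988Convergent, (2.28) p.259, (2.38) p.261] -/
structure Setting (G : Type*) [Group G] where
  /-- `G, Gᶜ, 𝔤ᶜ` inside `𝔸` -/
  𝓜 : B12RegularSpaces111.Model 𝔸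
  /-- the embedding of the gauge group into the units of `𝔸` -/
  ι : G →* 𝔸ˣ
  /-- `O(1)LMB` of (I.1.12) -/
  cB : ℝ
  /-- `β` of (2.34)–(2.39) -/
  βc : ℝ
  /-- `B` of (2.38) -/
  B : ℝ
  /-- `C` of (2.38) -/
  C : ℝ
  /-- `M` of (2.38) (real) -/
  Mr : ℝ
  /-- the term constants -/
  lf : LFConsts
  /-- the flow `(g_j, β_j)` -/
  flow : Flow

/-- The displayed MODEL PROVISOS of a setting: the gauge group is embedded into print's `G ⊂ Gᶜ` («U has values in the group G», «𝐔 … has values in Gᶜ»).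
Discharged by construction at 11d (`SU(N) ⊂ GL_N(ℂ)`); nothing of Bałaban. [cite: Balaban1987RG1, (1.10)–(1.11) p.262] -/
structure Setting.Laws {G : Type*} [Group G] (S : Setting 𝔸 G) : Prop where
  /-- `ι(G) ⊂ G` of the model -/
  ι_mem : ∀ g, S.ι g ∈ S.𝓜.G
  /-- `G ⊂ Gᶜ` -/
  G_le_Gc : S.𝓜.G ≤ S.𝓜.Gc

variable {P 𝔸}

/-- The `(I.1.12)` cubes of record inside `X`: the `LM`-cubes of `T^{(j)}` (= the `M`-cubes of `T^{(j+1)}`, `O(1) := 1` — a located reading of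
«of a size O(1)LM») meeting `X`, intersected with `X`, as regions. [cite: Balaban1987RG1, (1.12) p.262] -/
def cubesI (M j : ℕ) (Y : Set (Site P 0)) : Set (B12RegularSpaces111.Region P 0) :=
  {C | ∃ a ∈ cubeIndices P (side P.L M (j + 1)),
    (cubeEnl P (side P.L M (j + 1)) a 0 ∩ Y).Nonempty ∧ C = regionOfSet P (cubeEnl P (side P.L M (j + 1)) a 0 ∩ Y)}

/-- **The frame of `U^c_j(X, α₀, α₁)` OF RECORD** for `X ∈ 𝐃_j` read as the site set `Y`: the region `X`, its (I.1.12) cubes, `X̃⁻²` («taking away two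
layers of cubes from π_j»), and the residual functions (I.1.15). [cite: Balaban1987RG1, (1.11)–(1.16) p.262] -/
def frameI (Rz : Residual P 𝔸) (M j : ℕ) (Y : Set (Site P 0)) : B12RegularSpaces111.Frame P 0 𝔸 where
  X := regionOfSet P Y
  cubes := cubesI M j Y
  X₂ := regionOfSet P (innerT P (side P.L M j) 2 Y)
  bg := Rz.bgI j Y

/-- The layer regions of (2.34)∕(2.36)∕(2.39): `X ∩ (Ω_n ∖ Ω_{n+1})` for `n < j`, `X ∩ Ω_j` for `n = j`, nothing above.
[cite: Balaban1988Convergent, (2.34)–(2.39) p.261] -/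
def layerSet (j : ℕ) (Y : Set (Site P 0)) (Ω : ℕ → Set (Site P 0)) (n : ℕ) : Set (Site P 0) :=
  if n < j then Y ∩ (Ω n \ Ω (n + 1)) else if n = j then Y ∩ Ω j else ∅

/-- The cubes of condition (ii) (2.38) at layer `n`, intersected with `X`: for `n < j` the `M`-cubes `□` of `T^{(n)}` with «□ ⊂ Ω_n∖Ω_{n+2}, □∩Ω^c_{n+1} ≠ ∅»
(«of the size CML^nξ», `C := 1` — located reading), for `n = j` those with «□ ⊂ Ω_j and of the size CM». [cite: Balaban1988Convergent, (2.38) p.261] -/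
def cubesMS (M j : ℕ) (Y : Set (Site P 0)) (Ω : ℕ → Set (Site P 0)) (n : ℕ) : Set (B12RegularSpaces111.Region P 0) :=
  {C | ∃ a ∈ cubeIndices P (side P.L M n), (cubeEnl P (side P.L M n) a 0 ∩ Y).Nonempty ∧
    ((n < j ∧ cubeEnl P (side P.L M n) a 0 ⊆ Ω n \ Ω (n + 2) ∧ (cubeEnl P (side P.L M n) a 0 ∩ (Ω (n + 1))ᶜ).Nonempty) ∨
      (n = j ∧ cubeEnl P (side P.L M n) a 0 ⊆ Ω j)) ∧
    C = regionOfSet P (cubeEnl P (side P.L M n) a 0 ∩ Y)}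

/-- **The frame of `Ũ^c_j(X, α̃₀, α̃₁)` OF RECORD** along the sequence `{Ω_n}`: the region `X`, its layers, the (2.38) cubes, and the residual
functions (2.35). [cite: Balaban1988Convergent, (2.34)–(2.39) p.261] -/
def frameMS (Rz : Residual P 𝔸) (M j : ℕ) (Y : Set (Site P 0)) (Ω : ℕ → Set (Site P 0)) : B14RegularSpaces234.MSFrame P 0 𝔸 where
  X := regionOfSet P Y
  layer := fun n => regionOfSet P (layerSet j Y Ω n)
  cubes := cubesMS M j Y Ω
  bg := Rz.bgMS j Y

variable {G : Type*} [Group G]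

/-- **`U^c_j(X, α₀, α₁)` OF RECORD in `Φ`** (the space of (2.27)(ii)∕(iv) and (2.31)): [I]'s union of orbits `B12RegularSpaces111.space'` on the frame of
record, read in `Φ`. [cite: Balaban1988Convergent, (2.27)(ii) p.259; Balaban1987RG1, (1.11)–(1.16) p.262] -/
def spaceI (S : Setting 𝔸 G) (Rz : Residual P 𝔸) (M j : ℕ) (Y : Set (Site P 0)) (α₀ α₁ : ℝ) : Set (CPair P 𝔸) :=
  embedPair '' B12RegularSpaces111.space' S.𝓜 (frameI Rz M j Y) (B12RegularSpaces111.StepConsts.ofParams P S.cB j) α₀ α₁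

/-- **`Ũ^c_j(X, α̃₀, α̃₁)` OF RECORD in `Φ`** (the space of (2.41)(ii) and (2.42)) with `α̃₀ = {α_{0,n}}`, `α̃₁ = {α_{1,n}}` of (2.28) along the flow.
[cite: Balaban1988Convergent, (2.34)–(2.39), (2.41)(ii) p.261] -/
def spaceMS (S : Setting 𝔸 G) (Rz : Residual P 𝔸) (M j : ℕ) (Y : Set (Site P 0)) (Ω : ℕ → Set (Site P 0)) : Set (CPair P 𝔸) :=
  embedPair '' B14RegularSpaces234.space234 S.𝓜 (frameMS Rz M j Y Ω) (B14RegularSpaces234.MSConsts.ofParams P S.βc S.B S.C S.Mr j)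
    (fun n => S.lf.alpha0 (S.flow.g n)) (fun n => S.lf.alpha1 (S.flow.g n))

end Frames

/-! ## §4  The term VALUES and the tower of record -/

section Tower

variable (P : Params) (𝔸 : Type*) [NormedRing 𝔸] [NormedAlgebra ℂ 𝔸] [CompleteSpace 𝔸] (V : Type*) (M : ℕ)

/-- **THE TERM VALUES** — the only non-frame content of a §2 tower: the functions `𝐄^{(j)}(X, ·, z)` (with the coupling argument), `𝐑^{(j)}(X, ·)`,
`𝐁^{(j)}(X, ·, (A, {S_i}))` for `X ∈ 𝐃_j` of record, `z ∈ T_1^{(j)}`, on `Φ` and the fluctuation datum `SFluct` of `TkOfRecord`. Under an EXISTENTIAL law these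
are witness data (print defines them by the §3 recursion, not typed here). [cite: Balaban1988Convergent, (2.26)–(2.27) p.259, (2.30) p.260, (2.40)–(2.41) p.261] -/
structure TermValues where
  /-- `𝐄^{(j)}(X, (𝐔,𝐉), z)` at coupling `g` -/
  E : (j : ℕ) → (domSys P M j).Dom → Site P j → ℝ → CPair P 𝔸 → ℂ
  /-- `𝐑^{(j)}(X, (𝐔,𝐉))` -/
  R : (j : ℕ) → (domSys P M j).Dom → CPair P 𝔸 → ℂ
  /-- `𝐁^{(j)}(X, (𝐔,𝐉), A, {S_i ∩ X})` -/
  B : (j : ℕ) → (domSys P M j).Dom → CPair P 𝔸 → Tk.SFluct P V → ℂ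

variable {P 𝔸 V M} {G : Type*} [GaugeGroup G]

/-- **THE §2 TOWER OF RECORD** = PINNED FRAME ⊕ term values: flow, `𝐃_j` with `d_j`, the points `T_1^{(j)}`, the spaces of record, the embedding of
background fields, the gauge action and locality are fixed by the setting, the residual recipes and the sequence `{Ω_n}`; only `E, R, B` come from `t`.
[cite: Balaban1988Convergent, (2.23)–(2.42) pp.258–261] -/
def towerOfTerms (S : Setting 𝔸 G) (Rz : Residual P 𝔸) (M : ℕ) (Ω : ℕ → Set (Site P 0)) (t : TermValues P 𝔸 V M) :
    LFTower P G (CPair P 𝔸) (Site P 0 → S.𝓜.Gc) (Tk.SFluct P V) where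
  flow := S.flow
  sys := domSys P M
  Pt := fun j => Site P j
  finPt := fun _ => inferInstance
  E := t.E
  R := t.R
  B := t.B
  space := fun j X α₀ α₁ => spaceI S Rz M j (domSites P M j X) α₀ α₁
  spaceB := fun j X => spaceMS S Rz M j (domSites P M j X) Ω
  ofBackground := ofBackgroundC S.ι
  act := fun u => cAct (fun x => (u x : 𝔸ˣ))
  agreeOn := fun j X => agreeOnSet (domSites P M j X)

/-- The frame fields of the tower of record, by `rfl`. [cite: Balaban1988Convergent, (2.23) p.258 (bookkeeping)] -/
theorem towerOfTerms_flow (S : Setting 𝔸 G) (Rz : Residual P 𝔸) (M : ℕ) (Ω : ℕ → Set (Site P 0)) (t : TermValues P 𝔸 V M) :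
    (towerOfTerms S Rz M Ω t).flow = S.flow := rfl

/-- `𝐃_j` of the tower of record is `domSys`. [cite: Balaban1988Convergent, (2.26) p.259 (bookkeeping)] -/
theorem towerOfTerms_sys (S : Setting 𝔸 G) (Rz : Residual P 𝔸) (M : ℕ) (Ω : ℕ → Set (Site P 0)) (t : TermValues P 𝔸 V M) :
    (towerOfTerms S Rz M Ω t).sys = domSys P M := rfl

/-- The linear size of the tower of record is the torus tree length. [cite: Balaban1987RG1, p.257 (d_j)] -/
theorem towerOfTerms_dj (S : Setting 𝔸 G) (Rz : Residual P 𝔸) (M : ℕ) (Ω : ℕ → Set (Site P 0)) (t : TermValues P 𝔸 V M) (j : ℕ)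
    (X : ((towerOfTerms S Rz M Ω t).sys j).Dom) :
    ((towerOfTerms S Rz M Ω t).sys j).dj X = torusTreeLen (Subtype.val X : Finset (TPt P.d (domCount P M j))) := rfl

/-- The terms of the tower of record are the term values. [cite: Balaban1988Convergent, (2.26)–(2.27) p.259 (bookkeeping)] -/
theorem towerOfTerms_E (S : Setting 𝔸 G) (Rz : Residual P 𝔸) (M : ℕ) (Ω : ℕ → Set (Site P 0)) (t : TermValues P 𝔸 V M) :
    (towerOfTerms S Rz M Ω t).E = t.E := rfl

/-- The 𝐑-terms of the tower of record are the term values. [cite: Balaban1988Convergent, (2.30) p.260 (bookkeeping)] -/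
theorem towerOfTerms_R (S : Setting 𝔸 G) (Rz : Residual P 𝔸) (M : ℕ) (Ω : ℕ → Set (Site P 0)) (t : TermValues P 𝔸 V M) :
    (towerOfTerms S Rz M Ω t).R = t.R := rfl

/-- The 𝐁-terms of the tower of record are the term values. [cite: Balaban1988Convergent, (2.40)–(2.41) p.261 (bookkeeping)] -/
theorem towerOfTerms_B (S : Setting 𝔸 G) (Rz : Residual P 𝔸) (M : ℕ) (Ω : ℕ → Set (Site P 0)) (t : TermValues P 𝔸 V M) :
    (towerOfTerms S Rz M Ω t).B = t.B := rfl

/-- Locality in the tower of record IS agreement on the bonds of `X`. [cite: Balaban1988Convergent, (2.27)(i) p.259] -/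
theorem towerOfTerms_agreeOn (S : Setting 𝔸 G) (Rz : Residual P 𝔸) (M : ℕ) (Ω : ℕ → Set (Site P 0)) (t : TermValues P 𝔸 V M) (j : ℕ)
    (X : ((towerOfTerms S Rz M Ω t).sys j).Dom) (φ ψ : CPair P 𝔸) :
    (towerOfTerms S Rz M Ω t).agreeOn j X φ ψ ↔ agreeOnSet (domSites P M j X) φ ψ := Iff.rfl

/-- The gauge action of the tower of record is (1.10) on `Φ` for `Gᶜ`-valued gauge transformations. [cite: Balaban1988Convergent, (2.27)(iii) p.259] -/
theorem towerOfTerms_act (S : Setting 𝔸 G) (Rz : Residual P 𝔸) (M : ℕ) (Ω : ℕ → Set (Site P 0)) (t : TermValues P 𝔸 V M)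
    (u : Site P 0 → S.𝓜.Gc) (φ : CPair P 𝔸) : (towerOfTerms S Rz M Ω t).act u φ = cAct (fun x => (u x : 𝔸ˣ)) φ := rfl

/-- Background fields enter the tower of record through `ι`, with `𝐉 = 0`. [cite: Balaban1988Convergent, (2.23) p.258] -/
theorem towerOfTerms_ofBackground (S : Setting 𝔸 G) (Rz : Residual P 𝔸) (M : ℕ) (Ω : ℕ → Set (Site P 0)) (t : TermValues P 𝔸 V M)
    (U : GaugeField P 0 G) : (towerOfTerms S Rz M Ω t).ofBackground U = ofBackgroundC S.ι U := rfl

/-- The ZERO term values (no terms: the level-0 situation of Theorem 1's start `ρ₀ = exp[−(1∕g₀²)A − E]`). [cite: Balaban1988Convergent, Thm 1 p.262] -/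
def TermValues.zero : TermValues P 𝔸 V M where
  E := fun _ _ _ _ _ => 0
  R := fun _ _ _ => 0
  B := fun _ _ _ _ => 0

end Tower

/-! ## §5  The summation ranges of (2.26)–(2.27), (2.30), (2.41) OF RECORD and the action data (2.23) -/

section Ranges

variable (P : Params)

/-- The side (in fine sites) of the `MR_j`-cubes of `T^{(j)}` along the coupling sequence `g` (`R_j = RkOfRecord L r g_j`): the cubes of «Λ_j⁰ … removing
one layer of the MR_j-cubes», of `Λ_j^{∼−1}`, and of `Z_j^∼`. [cite: Balaban1988Convergent, (2.1) p.254, (2.26) p.259, (2.30) p.260] -/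
def zSide (ν : Stage7Numerics) (M : ℕ) (g : ℕ → ℝ) (j : ℕ) : ℕ :=
  dCubeSide P.L M (RkOfRecord P.L ν.r (g j)) j

/-- **`Λ_j⁰`** — «the set which is obtained by removing one layer of the MR_j-cubes from Λ_j». [cite: Balaban1988Convergent, (2.26) p.259] -/
def lambda0 (ν : Stage7Numerics) (M : ℕ) (g : ℕ → ℝ) (Λ : ℕ → Set (Site P 0)) (j : ℕ) : Set (Site P 0) :=
  innerT P (zSide P ν M g j) 1 (Λ j)

open Classical in
/-- **The (2.26)–(2.27) range**: the term `𝐄^{(j)}(X, ·, z)` occurs iff «z ∈ T_1^{(j)} ∩ Λ_j⁰», «X ∈ 𝐃_j, z ∈ X ⊂ Λ_j» (the point `z` of `T^{(j)}`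
read in `T_η` by `toFine`). [cite: Balaban1988Convergent, (2.26)–(2.27) p.259] -/
def admE (ν : Stage7Numerics) (M : ℕ) (g : ℕ → ℝ) (Λ : ℕ → Set (Site P 0)) (j : ℕ) (Y : Set (Site P 0)) (z : Site P j) : Bool :=
  decide (B10Eq38TorusDomains.toFine j z ∈ lambda0 P ν M g Λ j ∧ B10Eq38TorusDomains.toFine j z ∈ Y ∧ Y ⊆ Λ j)

open Classical in
/-- **The (2.30) range**: «the summation over localization domains X ∈ 𝐃_j contained in Λ_j^{∼−1}». [cite: Balaban1988Convergent, (2.30) p.260] -/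
def admR (ν : Stage7Numerics) (M : ℕ) (g : ℕ → ℝ) (Λ : ℕ → Set (Site P 0)) (j : ℕ) (Y : Set (Site P 0)) : Bool :=
  decide (Y ⊆ innerT P (zSide P ν M g j) 1 (Λ j))

open Classical in
/-- **The (2.41)(i) range**: «X ∩ Ω_j ≠ ∅ and X ∩ Z_j^∼ ≠ ∅», `Z_j = Λ_jᶜ` (2.3). [cite: Balaban1988Convergent, (2.41)(i) p.261, (2.3) p.255] -/
def admB (ν : Stage7Numerics) (M : ℕ) (g : ℕ → ℝ) (Ω Λ : ℕ → Set (Site P 0)) (j : ℕ) (Y : Set (Site P 0)) : Bool :=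
  decide ((Y ∩ Ω j).Nonempty ∧ (Y ∩ enlT P (zSide P ν M g j) 1 (Λ j)ᶜ).Nonempty)

variable {P}

/-- The three ranges read off a `towerOfTerms` domain. [cite: Balaban1988Convergent, (2.26)–(2.27) p.259 (bookkeeping)] -/
theorem admE_eq_true_iff (ν : Stage7Numerics) (M : ℕ) (g : ℕ → ℝ) (Λ : ℕ → Set (Site P 0)) (j : ℕ) (Y : Set (Site P 0)) (z : Site P j) :
    admE P ν M g Λ j Y z = true ↔
      B10Eq38TorusDomains.toFine j z ∈ lambda0 P ν M g Λ j ∧ B10Eq38TorusDomains.toFine j z ∈ Y ∧ Y ⊆ Λ j := by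
  classical
  simp [admE]

/-- The (2.30) range, unfolded. [cite: Balaban1988Convergent, (2.30) p.260 (bookkeeping)] -/
theorem admR_eq_true_iff (ν : Stage7Numerics) (M : ℕ) (g : ℕ → ℝ) (Λ : ℕ → Set (Site P 0)) (j : ℕ) (Y : Set (Site P 0)) :
    admR P ν M g Λ j Y = true ↔ Y ⊆ innerT P (zSide P ν M g j) 1 (Λ j) := by
  classical
  simp [admR]

/-- The (2.41)(i) range, unfolded. [cite: Balaban1988Convergent, (2.41)(i) p.261 (bookkeeping)] -/
theorem admB_eq_true_iff (ν : Stage7Numerics) (M : ℕ) (g : ℕ → ℝ) (Ω Λ : ℕ → Set (Site P 0)) (j : ℕ) (Y : Set (Site P 0)) :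
    admB P ν M g Ω Λ j Y = true ↔ (Y ∩ Ω j).Nonempty ∧ (Y ∩ enlT P (zSide P ν M g j) 1 (Λ j)ᶜ).Nonempty := by
  classical
  simp [admB]

end Ranges

section Action

variable {P : Params} {𝔸 : Type*} [NormedRing 𝔸] [NormedAlgebra ℂ 𝔸] [CompleteSpace 𝔸] {V : Type*} {G : Type*} [GaugeGroup G]

/-- **THE ACTION DATA (2.23) OF RECORD** for the sequences `{Ω_j}, {Λ_j}`: r11's `B14.Eq225Concrete.concrete` (A(1∕g_k²(·),·) = `smearedWilson (invSq …)`
with (2.24), A(φ_j,·) = `smearedWilson (φ j)`) on the tower of record, with the ranges of record and the residual smearing functions `φ_j`.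
[cite: Balaban1988Convergent, (2.23)–(2.25) pp.258–259] -/
def actionDataOfTerms (S : Setting 𝔸 G) (Rz : Residual P 𝔸) (ν : Stage7Numerics) (M : ℕ) (g : ℕ → ℝ) (Ω Λ : ℕ → Set (Site P 0))
    (t : TermValues P 𝔸 V M) (k : ℕ) (a : Tk.SFluct P V) (Ek : ℝ) : LFActionData P G (towerOfTerms S Rz M Ω t) :=
  B14.Eq225Concrete.concrete (towerOfTerms S Rz M Ω t)
    (fun j X z => admE P ν M g Λ j (domSites P M j X) z)
    (fun j X => admR P ν M g Λ j (domSites P M j X))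
    (fun j X => admB P ν M g Ω Λ j (domSites P M j X))
    Rz.phi k a Ek

/-- **(2.23) on the data of record** (= `B14.Eq225Concrete.action23_concrete` at the tower of record): `A_k = −A(1∕g_k²(·), U) + 𝐄_k(U) + 𝐑_k(U) + 𝐁_k(U, A) − E_k`.
[cite: Balaban1988Convergent, (2.23) p.258, (2.25) p.259] -/
theorem action23_actionDataOfTerms (S : Setting 𝔸 G) (Rz : Residual P 𝔸) (ν : Stage7Numerics) (M : ℕ) (g : ℕ → ℝ)
    (Ω Λ : ℕ → Set (Site P 0)) (t : TermValues P 𝔸 V M) (k : ℕ) (a : Tk.SFluct P V) (Ek : ℝ) (U : GaugeField P 0 G) :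
    (actionDataOfTerms S Rz ν M g Ω Λ t k a Ek).action23 k U =
      - B14.Eq225Concrete.smearedWilson (B14.LocalCoupling.invSq S.flow Rz.phi k) U
        + B14.Eq225Concrete.E225 (towerOfTerms S Rz M Ω t) (fun j X z => admE P ν M g Λ j (domSites P M j X) z) Rz.phi k U
        + B14.Eq225Concrete.R230 (towerOfTerms S Rz M Ω t) (fun j X => admR P ν M g Λ j (domSites P M j X)) k U
        + B14.Eq225Concrete.B240 (towerOfTerms S Rz M Ω t) (fun j X => admB P ν M g Ω Λ j (domSites P M j X)) a k U - Ek :=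
  B14.Eq225Concrete.action23_concrete _ _ _ _ _ _ _ _ _

end Action

section RealReading

variable {P : Params} {𝔸 : Type*} [NormedRing 𝔸] [NormedAlgebra ℂ 𝔸] {V : Type*} {G : Type*} [Group G]

open Classical in
/-- **THE [I] (0.24) READING of the term values**: restricted to real `G`-valued fields (through `ι`, `𝐉 = 0`) and summed over the points `z ∈ X` of `T^{(j)}`,
the `𝐄`-values are a `Node00.LocalizedFamily` (object ₈'s shape of [I] (0.24) «𝐄^{(j)}(U) = Σ_{X ∈ 𝐃_j} 𝐄^{(j)}(X, U)») on the domains of record, at the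
coupling `g_{j−1}` of the flow: `𝐄^{(j)}(X, U) = Σ_{z ∈ X} Re 𝐄^{(j)}(X, (ι U, 0), z)`. [cite: Balaban1987RG1, (0.24) p.257; Balaban1988Convergent, (2.26)–(2.27) p.259] -/
def realFamilyOfTerms (S : Setting 𝔸 G) (M : ℕ) (t : TermValues P 𝔸 V M) : LocalizedFamily P G where
  sys := domSys P M
  sites := domSites P M
  term := fun j X U => ∑ z : Site P j,
    if B10Eq38TorusDomains.toFine j z ∈ domSites P M j X then (t.E j X z (S.flow.g (j - 1)) (ofBackgroundC S.ι U)).re else 0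

/-- **(2.27)(i) ⇒ [I]'s «depending on U restricted to X»**: if every `𝐄^{(j)}(X, ·, z)` depends on the configuration through the bonds of `X` only
(the shape of `Step.LFHyp.localDepE` on the tower of record), the real reading is `LocalizedFamily.Localized` in ₈'s sense. [cite: Balaban1987RG1, (0.24) p.257; Balaban1988Convergent, (2.27)(i) p.259] -/
theorem realFamilyOfTerms_localized (S : Setting 𝔸 G) (M : ℕ) (t : TermValues P 𝔸 V M)
    (hloc : ∀ j (X : (domSys P M j).Dom) z g φ ψ, agreeOnSet (domSites P M j X) φ ψ → t.E j X z g φ = t.E j X z g ψ) :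
    (realFamilyOfTerms S M t).Localized := by
  intro j X U U' hUU'
  simp only [realFamilyOfTerms]
  refine Finset.sum_congr rfl fun z _ => ?_
  rw [hloc j X z (S.flow.g (j - 1)) _ _ (agreeOnSet_ofBackgroundC S.ι hUU')]

end RealReading

end Sect2

/-! ## §6  OF RECORD: the tower and the action data along a (2.18) sequence of record -/

section OfRecord

variable (F : T4Family) (N : ℕ) [NeZero N] {𝔸 : Type*} [NormedRing 𝔸] [NormedAlgebra ℂ 𝔸] [CompleteSpace 𝔸] (V : Type*)

/-- **THE §2 TOWER OF RECORD along an admissible sequence** `s` of (2.18) at step `k` on the torus `F.P K`: frame pinned (flow, `𝐃_j`, `d_j`, `T_1^{(j)}`, the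
spaces of record along `{Ω_j}`, the embedding of `SU(N)`-fields, gauge action, locality), term values `t`. [cite: Balaban1988Convergent, (2.23)–(2.42) pp.258–261] -/
def sect2TowerOfRecord (K : ℕ) (S : Sect2.Setting 𝔸 (SU N)) (Rz : Sect2.Residual (F.P K) 𝔸) {ν : Stage7Numerics} {M : ℕ} {g : ℕ → ℝ} {k : ℕ}
    (s : SeqOfRecord F ν M g K k) (t : Sect2.TermValues (F.P K) 𝔸 V M) :
    LFTower (F.P K) (SU N) (Sect2.CPair (F.P K) 𝔸) (Site (F.P K) 0 → S.𝓜.Gc) (Tk.SFluct (F.P K) V) :=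
  Sect2.towerOfTerms S Rz M s.Ω t

/-- **THE ACTION DATA (2.23) OF RECORD along `s`** with the fluctuation datum `a` and the constant `E_k`. [cite: Balaban1988Convergent, (2.23) p.258] -/
def sect2ActionDataOfRecord (K : ℕ) (S : Sect2.Setting 𝔸 (SU N)) (Rz : Sect2.Residual (F.P K) 𝔸) {ν : Stage7Numerics} {M : ℕ} {g : ℕ → ℝ}
    {k : ℕ} (s : SeqOfRecord F ν M g K k) (t : Sect2.TermValues (F.P K) 𝔸 V M) (a : Tk.SFluct (F.P K) V) (Ek : ℝ) :
    LFActionData (F.P K) (SU N) (sect2TowerOfRecord F N V K S Rz s t) :=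
  Sect2.actionDataOfTerms S Rz ν M g s.Ω s.Λ t k a Ek

/-- The tower of record depends on the sequence only through `{Ω_j}` (the spaces `Ũ^c_j`); the ranges carry `{Λ_j}`. [cite: Balaban1988Convergent, (2.34) p.261 (bookkeeping)] -/
theorem sect2TowerOfRecord_eq (K : ℕ) (S : Sect2.Setting 𝔸 (SU N)) (Rz : Sect2.Residual (F.P K) 𝔸) {ν : Stage7Numerics} {M : ℕ} {g : ℕ → ℝ}
    {k : ℕ} (s : SeqOfRecord F ν M g K k) (t : Sect2.TermValues (F.P K) 𝔸 V M) :
    sect2TowerOfRecord F N V K S Rz s t = Sect2.towerOfTerms S Rz M s.Ω t := rfl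

end OfRecord

end

end Literature.MathematicalPhysics.QuantumFieldTheory.Balaban1983to89.Node00
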